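import Literature.Computability.FineGrained.DTWReductionProgram
import HarnessLib

/-!
# OV from subquadratic one-dimensional DTW: the writing loops and the whole build

Continuation of `Literature.Computability.FineGrained.DTWReductionProgram` (the word-RAM program
of the reduction from Orthogonal Vectors to DTW on one-dimensional curves, K. Bringmann,
M. Künnemann, FOCS 2015, Thm. 1.1 / Thm. 3.3): verification of

* the `x`-loop (`xBody_spec`, `xLoop_spec`): cell `Bv + 2 + p` receives `2 · ovXval I p mod Pw`,
  the point of the first curve decoded arithmetically from `p` (`DTWOVDecode.getElem_ovX`);
* the `y`-loop (`yBody_spec`, `yLoop_spec`) likewise for the second curve;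
* the header, the clearing of the scratch, and **the whole build** (`Params.pre_spec`): on the
  initial memory of the `OV` input, `pre` ends within `Tpre` steps in the closed-form memory
  `finMem` presenting the emulated `DTW` input `dtwInput I` (`finData`, `ycell`).

## References

* K. Bringmann, M. Künnemann, FOCS 2015 (arXiv:1502.01063), Thm. 1.1, §3.1.
* T. Nipkow, G. Klein, *Concrete Semantics with Isabelle/HOL*, Springer 2014, §12.
-/

namespace Literature.Computability.FineGrained

open Cryptography Cryptography.WordRAM Cryptography.WordRAM.SProg

namespace DTWRed

namespace Prog

/-! ### Bit arithmetic -/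

/-- The `x`-side coordinate value by `xor`: `xvalN` at even positions, `xvalN ∘ not` at odd ones,
is `1 + 2 (bit xor parity)`. [folklore] -/
theorem vgXval_eq (bit : ℕ → Bool) (q : ℕ) :
    vgXval bit q = q * 6 + (((bit (q / 2)).toNat ^^^ (q % 2)) * 2 + 1) := by
  unfold vgXval xvalN
  rcases Nat.mod_two_eq_zero_or_one q with h | h <;> rw [h] <;> cases bit (q / 2) <;> simp [Nat.mul_comm]

/-- The `y`-side coordinate value by masking: `yvalN` at even positions, `2` at odd ones, is
`2 - 2 ((parity xor 1) and bit)`. [folklore] -/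
theorem vgYval_eq (bit : ℕ → Bool) (q : ℕ) :
    vgYval bit q = q * 6 + 2 - (((q % 2) ^^^ 1) &&& (bit (q / 2)).toNat) * 2 ∧
      (((q % 2) ^^^ 1) &&& (bit (q / 2)).toNat) * 2 ≤ 2 := by
  unfold vgYval yvalN
  rcases Nat.mod_two_eq_zero_or_one q with h | h <;> rw [h] <;> cases bit (q / 2) <;> simp [Nat.mul_comm]

namespace Params

variable (g : Params) {W : ℕ} {O : List ℕ → List ℕ}

/-! ### The intended data memory, stage by stage -/

/-- The emulated cell of the first curve: `2 · ovXval p mod Pw`. [folklore] -/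
def xcell (p : ℕ) : ℕ := (2 * ovXval g.I p) % g.Pw

/-- The emulated cell of the second curve: `2 · ovYval q mod Pw`. [folklore] -/
def ycellY (q : ℕ) : ℕ := (2 * ovYval g.I q) % g.Pw

/-- Data after `p` points of the first curve: the relocated input below `Bv`, the points at
`Bv + 2, …, Bv + 2 + p - 1`. [folklore] -/
noncomputable def xData (p a : ℕ) : ℕ :=
  if a < g.Bv then relocated g.x a
  else if g.Bv + 2 ≤ a ∧ a < g.Bv + 2 + p then g.xcell (a - (g.Bv + 2))
  else 0

/-- Data after the first curve and `q` points of the second. [folklore] -/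
noncomputable def yData (q a : ℕ) : ℕ :=
  if a < g.Bv then relocated g.x a
  else if g.Bv + 2 ≤ a ∧ a < g.Bv + 2 + g.lenX then g.xcell (a - (g.Bv + 2))
  else if g.Bv + 2 + g.lenX ≤ a ∧ a < g.Bv + 2 + g.lenX + q then g.ycellY (a - (g.Bv + 2 + g.lenX))
  else 0

/-- `xData 0` is the relocated memory. [folklore] -/
theorem xData_zero (a : ℕ) : g.xData 0 a = relocated g.x a := by
  unfold xData
  by_cases h : a < g.Bv
  · rw [if_pos h]
  · rw [if_neg h, if_neg (by omega), g.relocated_of_Bv_le (by omega)]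

/-- Writing the next point. [folklore] -/
theorem xData_succ (p : ℕ) (a : ℕ) :
    g.xData (p + 1) a = Function.update (g.xData p) (g.Bv + 2 + p) (g.xcell p) a := by
  by_cases ha : a = g.Bv + 2 + p
  · subst ha; rw [Function.update_self]; unfold xData
    rw [if_neg (by omega), if_pos ⟨by omega, by omega⟩]; congr 1; omega
  · rw [Function.update_of_ne ha]; unfold xData
    by_cases h1 : a < g.Bv
    · rw [if_pos h1, if_pos h1]
    · rw [if_neg h1, if_neg h1]
      by_cases h2 : g.Bv + 2 ≤ a ∧ a < g.Bv + 2 + p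
      · rw [if_pos (by omega), if_pos h2]
      · rw [if_neg (by omega), if_neg h2]

/-- `yData 0 = xData lenX`. [folklore] -/
theorem yData_zero (a : ℕ) : g.yData 0 a = g.xData g.lenX a := by
  unfold yData xData
  by_cases h1 : a < g.Bv
  · rw [if_pos h1, if_pos h1]
  · rw [if_neg h1, if_neg h1]
    by_cases h2 : g.Bv + 2 ≤ a ∧ a < g.Bv + 2 + g.lenX
    · rw [if_pos h2, if_pos h2]
    · rw [if_neg h2, if_neg h2, if_neg (by omega)]

/-- Writing the next point of the second curve. [folklore] -/
theorem yData_succ (q : ℕ) (a : ℕ) :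
    g.yData (q + 1) a = Function.update (g.yData q) (g.Bv + 2 + g.lenX + q) (g.ycellY q) a := by
  by_cases ha : a = g.Bv + 2 + g.lenX + q
  · subst ha; rw [Function.update_self]; unfold yData
    rw [if_neg (by omega), if_neg (by omega), if_pos ⟨by omega, by omega⟩]; congr 1; omega
  · rw [Function.update_of_ne ha]; unfold yData
    by_cases h1 : a < g.Bv
    · rw [if_pos h1, if_pos h1]
    · rw [if_neg h1, if_neg h1]
      by_cases h2 : g.Bv + 2 ≤ a ∧ a < g.Bv + 2 + g.lenX
      · rw [if_pos h2, if_pos h2]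
      · rw [if_neg h2, if_neg h2]
        by_cases h3 : g.Bv + 2 + g.lenX ≤ a ∧ a < g.Bv + 2 + g.lenX + q
        · rw [if_pos (by omega), if_pos h3]
        · rw [if_neg (by omega), if_neg h3]

/-- The input bits are readable at every stage: below `Bv` the data is the relocated input. [folklore] -/
theorem xData_input (p : ℕ) {a : ℕ} (ha : a < g.Bv) : g.xData p a = relocated g.x a := by
  unfold xData; rw [if_pos ha]

/-- The input bits are readable at every stage (second curve). [folklore] -/
theorem yData_input (q : ℕ) {a : ℕ} (ha : a < g.Bv) : g.yData q a = relocated g.x a := by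
  unfold yData; rw [if_pos ha]

/-! ### The `x`-loop: the decoding of one point -/

/-- The scratch registers of the `x`-loop body are `43–55`; a frame condition. [folklore] -/
def XFrame (m m' : ℕ → ℕ) : Prop := ∀ a, a < 43 ∨ 55 < a → m' a = m a

/-- Frames compose. [folklore] -/
theorem XFrame.trans {m₁ m₂ m₃ : ℕ → ℕ} (h₁ : XFrame m₁ m₂) (h₂ : XFrame m₂ m₃) : XFrame m₁ m₃ :=
  fun a ha => (h₂ a ha).trans (h₁ a ha)

/-- **The point of a vector gadget** (`xPoint`): from `r49 = q`, `r51 = q mod 2`, `r52 = b ≤ 1`,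
`r53 := 6 q + 1 + 2 (b xor (q mod 2))`. [folklore] -/
theorem xPoint_spec (hF : g.Fits W) {m : ℕ → ℕ} {q b : ℕ} (h49 : m 49 = q) (h51 : m 51 = q % 2)
    (h52 : m 52 = b) (hb : b ≤ 1) (hq : q < g.LK) :
    Achieves W O xPoint m (fun m' => m' 53 = q * 6 + ((b ^^^ (q % 2)) * 2 + 1) ∧ XFrame m m') 5 := by
  obtain ⟨hX, hXLx, hBv, hSv, htop, hNyV, hPwV, hcDV, hLx, edd, eL, eK1, eLX, eLY, eK2, eper, eperY, eLK,
    elenX, elenY, eNy, eM1, eM2, eB0, eSVG, erho1, eSNVG, esig3, ethr, h12, hSVG, hSNVG, hL1, hA, hrho,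
    hrs, hK2A, hLXA, hMK, hnrho, hnsig⟩ := g.facts hF
  have hW1 : 1 ≤ W := by have := hF.ws_lt; omega
  have h2W : 2 ≤ 2 ^ W := by
    calc (2 : ℕ) = 2 ^ 1 := rfl
      _ ≤ 2 ^ W := Nat.pow_le_pow_right (by norm_num) hW1
  have hxor : b ^^^ (q % 2) ≤ 1 := by
    have hb' : b < 2 := by omega
    have hq' : q % 2 < 2 := Nat.mod_lt _ (by norm_num)
    have := Nat.xor_lt_two_pow (n := 1) hb' hq'
    omega
  refine achieves_block_of_eq (fun m' hm' => ?_) le_rfl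
  simp (disch := first | omega | decide) only [execOps_cons, execOps_nil, execOp, Operand.write,
    Operand.read, merge_apply_of_lt, update_merge_of_lt, Function.update_self, Function.update_of_ne,
    BinOp.eval_add_of_lt, BinOp.eval_mul_of_lt, BinOp.eval_bxor_of_lt, h49, h51, h52] at hm'
  subst hm'
  refine ⟨?_, fun a ha => ?_⟩
  · simp (disch := first | omega | decide) only [merge_apply_of_lt, Function.update_self]
  · by_cases h : a < 100
    · rw [merge_apply_of_lt h]; simp (disch := omega) only [Function.update_of_ne]
    · rw [merge_apply_of_le (by omega)]


/-- `(k mod n) d + ℓ` addresses an `A`-bit: it is below `n d`. [folklore] -/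
theorem mod_mul_add_lt {k ℓ : ℕ} (hn : 1 ≤ g.n) (hℓ : ℓ < g.d) : k % g.n * g.d + ℓ < g.n * g.d := by
  have h1 : k % g.n < g.n := Nat.mod_lt _ hn
  calc k % g.n * g.d + ℓ < k % g.n * g.d + g.d := by omega
    _ = (k % g.n + 1) * g.d := by ring
    _ ≤ g.n * g.d := Nat.mul_le_mul_right _ h1

/-- **Inside the vector gadgets** (`xVector`): from `r49 = q < L`, `r48 = k'`, `r45 = k`, the
registers `n, d, X` and the relocated input below `Bv`, `r53 :=` the point `q` of the vector
gadget of `e` (if `k' = 0`) or of `a_{k mod n} 0` (if `k' ≠ 0`). [folklore] -/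
theorem xVector_spec (hF : g.Fits W) (hn : 1 ≤ g.n) {m : ℕ → ℕ} {q k' k : ℕ} (h49 : m 49 = q)
    (h48 : m 48 = k') (h45 : m 45 = k) (h3 : m 3 = g.d) (h2 : m 2 = g.n) (h0 : m 0 = g.X)
    (hq : q < g.L) (hD : ∀ a, 100 ≤ a → a < g.Bv → m a = relocated g.x a) :
    Achieves W O xVector m
      (fun m' => m' 53 = (if k' = 0 then vgXval (fun ℓ => decide (ℓ = g.d)) q
          else vgXval (abit g.I (k % g.n)) q) ∧ XFrame m m') 18 := by
  obtain ⟨hX, hXLx, hBv, hSv, htop, hNyV, hPwV, hcDV, hLx, edd, eL, eK1, eLX, eLY, eK2, eper, eperY, eLK,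
    elenX, elenY, eNy, eM1, eM2, eB0, eSVG, erho1, eSNVG, esig3, ethr, h12, hSVG, hSNVG, hL1, hA, hrho,
    hrs, hK2A, hLXA, hMK, hnrho, hnsig⟩ := g.facts hF
  have hqd : q / 2 ≤ g.d := by omega
  have hqLK : q < g.LK := by omega
  unfold xVector
  -- block 1: ℓ and parity
  refine Achieves.seqs_cons (R := fun m₁ => m₁ 50 = q / 2 ∧ m₁ 51 = q % 2 ∧
      ∀ a, a ≠ 50 → a ≠ 51 → m₁ a = m a) (T₁ := 2) (T₂ := 16) ?_ ?_
  · refine achieves_block_of_eq (fun m' hm' => ?_) le_rfl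
    simp (disch := first | omega | decide) only [execOps_cons, execOps_nil, execOp, Operand.write,
      Operand.read, merge_apply_of_lt, update_merge_of_lt, Function.update_of_ne,
      BinOp.eval_div, BinOp.eval_mod, h49] at hm'
    subst hm'
    refine ⟨?_, ?_, fun a h50 h51 => ?_⟩
    · simp (disch := first | omega | decide) only [merge_apply_of_lt, Function.update_self,
        Function.update_of_ne]
    · simp (disch := first | omega | decide) only [merge_apply_of_lt, Function.update_self]
    · by_cases h : a < 100
      · rw [merge_apply_of_lt h]; simp (disch := omega) only [Function.update_of_ne]
      · rw [merge_apply_of_le (by omega)]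
  rintro m₁ ⟨q50, q51, qf⟩
  have q48 : m₁ 48 = k' := (qf 48 (by omega) (by omega)).trans h48
  have q49 : m₁ 49 = q := (qf 49 (by omega) (by omega)).trans h49
  -- the bit, then the point
  refine Achieves.seqs_cons (R := fun m₂ => m₂ 52 = (if k' = 0 then (decide (q / 2 = g.d)).toNat
      else (abit g.I (k % g.n) (q / 2)).toNat) ∧ m₂ 49 = q ∧ m₂ 51 = q % 2 ∧
      ∀ a, a < 43 ∨ 55 < a → m₂ a = m a) (T₁ := 11) (T₂ := 5) ?_ ?_
  · refine Achieves.ifz (T := 9) (fun hz => ?_) (fun hnz => ?_)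
    · -- `k' = 0`: the extra vector `e`, bit `[ℓ = d]`
      have hk : k' = 0 := by simpa [Operand.read, q48] using hz
      refine achieves_block_of_eq (fun m' hm' => ?_) (by decide)
      have q3 : m₁ 3 = g.d := (qf 3 (by omega) (by omega)).trans h3
      simp (disch := first | omega | decide) only [execOps_cons, execOps_nil, execOp, Operand.write,
        Operand.read, merge_apply_of_lt, update_merge_of_lt, BinOp.eval_eq, q50, q3] at hm'
      subst hm'
      refine ⟨?_, ?_, ?_, fun a ha => ?_⟩
      · rw [merge_apply_of_lt (by omega), Function.update_self, if_pos hk, CliqueRed.ite_eq_toNat_decide]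
      · rw [merge_apply_of_lt (by omega), Function.update_of_ne (by omega), q49]
      · rw [merge_apply_of_lt (by omega), Function.update_of_ne (by omega), q51]
      · by_cases h : a < 100
        · rw [merge_apply_of_lt h, Function.update_of_ne (by omega), qf a (by omega) (by omega)]
        · rw [merge_apply_of_le (by omega), qf a (by omega) (by omega)]
    · -- `k' ≠ 0`: the vector `a_{k mod n} 0`
      have hk : k' ≠ 0 := by simpa [Operand.read, q48] using hnz
      refine Achieves.seqs_cons (R := fun m₂ => m₂ 43 = (if q / 2 < g.d then 1 else 0) ∧
          ∀ a, a ≠ 43 → m₂ a = m₁ a) (T₁ := 1) (T₂ := 8) ?_ ?_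
      · refine achieves_block_of_eq (fun m' hm' => ?_) le_rfl
        have q3 : m₁ 3 = g.d := (qf 3 (by omega) (by omega)).trans h3
        simp (disch := first | omega | decide) only [execOps_cons, execOps_nil, execOp, Operand.write,
          Operand.read, merge_apply_of_lt, update_merge_of_lt, BinOp.eval_lt, q50, q3] at hm'
        subst hm'
        refine ⟨by rw [merge_apply_of_lt (by omega), Function.update_self], fun a h43 => ?_⟩
        by_cases h : a < 100
        · rw [merge_apply_of_lt h, Function.update_of_ne h43]
        · rw [merge_apply_of_le (by omega)]
      rintro m₂ ⟨s43, sf⟩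
      refine Achieves.seqs_cons (T₁ := 8) (T₂ := 0) ?_ (fun _ h => Achieves.seqs_nil h)
      refine Achieves.ifz (T := 6) (fun hz' => ?_) (fun hnz' => ?_)
      · -- `ℓ ≥ d`: bit `0`
        have hℓ : ¬ q / 2 < g.d := by
          simp only [Operand.read, s43] at hz'; intro h; simp [h] at hz'
        refine achieves_block_of_eq (fun m' hm' => ?_) (by decide)
        simp (disch := first | omega | decide) only [execOps_cons, execOps_nil, execOp, Operand.write,
          Operand.read, update_merge_of_lt, BinOp.eval_band, Nat.and_self] at hm'
        subst hm'
        refine ⟨?_, ?_, ?_, fun a ha => ?_⟩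
        · rw [merge_apply_of_lt (by omega), Function.update_self, if_neg hk]
          unfold abit; rw [dif_neg (by rintro ⟨-, h⟩; exact hℓ h)]; rfl
        · rw [merge_apply_of_lt (by omega), Function.update_of_ne (by omega), sf 49 (by omega), q49]
        · rw [merge_apply_of_lt (by omega), Function.update_of_ne (by omega), sf 51 (by omega), q51]
        · by_cases h : a < 100
          · rw [merge_apply_of_lt h, Function.update_of_ne (by omega), sf a (by omega),
              qf a (by omega) (by omega)]
          · rw [merge_apply_of_le (by omega), sf a (by omega), qf a (by omega) (by omega)]
      · -- `ℓ < d`: read the input bit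
        have hℓ : q / 2 < g.d := by
          simp only [Operand.read, s43] at hnz'; by_contra h; simp [h] at hnz'
        have hlt := g.mod_mul_add_lt (k := k) hn hℓ
        have haddr : m₂ (k % g.n * g.d + q / 2 + g.X + 2) = (abit g.I (k % g.n) (q / 2)).toNat := by
          rw [sf _ (by omega), qf _ (by omega) (by omega), hD _ (by omega) (by omega),
            show k % g.n * g.d + q / 2 + g.X + 2 = g.X + (2 + (k % g.n * g.d + q / 2)) by omega,
            g.relocated_X_add, g.x_getD_A (Nat.mod_lt _ hn) hℓ]
        have s45 : m₂ 45 = k := by rw [sf 45 (by omega), qf 45 (by omega) (by omega), h45]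
        have s2 : m₂ 2 = g.n := by rw [sf 2 (by omega), qf 2 (by omega) (by omega), h2]
        have s3 : m₂ 3 = g.d := by rw [sf 3 (by omega), qf 3 (by omega) (by omega), h3]
        have s0 : m₂ 0 = g.X := by rw [sf 0 (by omega), qf 0 (by omega) (by omega), h0]
        have s50 : m₂ 50 = q / 2 := by rw [sf 50 (by omega), q50]
        have hbit : (abit g.I (k % g.n) (q / 2)).toNat ≤ 1 := Bool.toNat_le _
        refine achieves_block_of_eq (fun m' hm' => ?_) le_rfl
        simp (disch := first | omega | decide) only [execOps_cons, execOps_nil, execOp, Operand.write,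
          Operand.read, merge_apply_of_lt, merge_apply_of_le, update_merge_of_lt, Function.update_self,
          Function.update_of_ne, BinOp.eval_add_of_lt, BinOp.eval_mul_of_lt, BinOp.eval_mod,
          BinOp.eval_band, Nat.and_self, s45, s2, s3, s0, s50, haddr] at hm'
        subst hm'
        refine ⟨?_, ?_, ?_, fun a ha => ?_⟩
        · rw [merge_apply_of_lt (by omega), Function.update_self, if_neg hk]
        · rw [merge_apply_of_lt (by omega)]; simp (disch := omega) only [Function.update_of_ne]
          rw [sf 49 (by omega), q49]
        · rw [merge_apply_of_lt (by omega)]; simp (disch := omega) only [Function.update_of_ne]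
          rw [sf 51 (by omega), q51]
        · by_cases h : a < 100
          · rw [merge_apply_of_lt h]; simp (disch := omega) only [Function.update_of_ne]
            rw [sf a (by omega), qf a (by omega) (by omega)]
          · rw [merge_apply_of_le (by omega), sf a (by omega), qf a (by omega) (by omega)]
  -- the point
  rintro m₂ ⟨t52, t49, t51, tf⟩
  have hb : (if k' = 0 then (decide (q / 2 = g.d)).toNat else (abit g.I (k % g.n) (q / 2)).toNat) ≤ 1 := by
    split_ifs <;> exact Bool.toNat_le _
  refine Achieves.seqs_cons (T₁ := 5) (T₂ := 0) ?_ (fun _ h => Achieves.seqs_nil h)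
  refine (g.xPoint_spec hF t49 t51 t52 hb hqLK).mono (fun m₃ ⟨h53, hfr⟩ => ⟨?_, fun a ha => ?_⟩) le_rfl
  · rw [h53]
    split_ifs with hk
    · rw [vgXval_eq]
    · rw [vgXval_eq]
  · rw [hfr a (by unfold XFrame at *; omega), tf a ha]


/-- The value of an `x`-side normalised vector gadget past its first block. [folklore] -/
def nvgXtail (k r : ℕ) : ℕ :=
  if (r - g.K1) % g.LK < g.L then
    (if (r - g.K1) / g.LK = 0 then vgXval (fun ℓ => decide (ℓ = g.d)) ((r - g.K1) % g.LK)
      else vgXval (abit g.I (k % g.n)) ((r - g.K1) % g.LK))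
  else g.M1

/-- `nvgXval` in terms of `nvgXtail`. [folklore] -/
theorem nvgXval_eq (k r : ℕ) : nvgXval g.I (k % g.n) r = if r < g.K1 then g.M1 else g.nvgXtail k r := rfl

/-- `ovXval` in the program's terms. [folklore] -/
theorem ovXval_eq (p : ℕ) : ovXval g.I p = if p < g.K2 then g.M2 else
    if (p - g.K2) % g.per < g.LX then nvgXval g.I ((p - g.K2) / g.per % g.n) ((p - g.K2) % g.per)
    else g.M2 := rfl

/-- **Inside an `x`-side normalised vector gadget** (`xGadget`): from `r46 = r ≥ κ₁` (and the
registers of `xVector`), `r53 := nvgXtail k r`. [folklore] -/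
theorem xGadget_spec (hF : g.Fits W) (hn : 1 ≤ g.n) {m : ℕ → ℕ} {r k : ℕ} (h46 : m 46 = r)
    (h45 : m 45 = k) (h6 : m 6 = g.K1) (h26 : m 26 = g.LK) (h5 : m 5 = g.L) (h20 : m 20 = g.M1)
    (h3 : m 3 = g.d) (h2 : m 2 = g.n) (h0 : m 0 = g.X) (hr : g.K1 ≤ r) (hrX : r < g.LX)
    (hD : ∀ a, 100 ≤ a → a < g.Bv → m a = relocated g.x a) :
    Achieves W O xGadget m (fun m' => m' 53 = g.nvgXtail k r ∧ XFrame m m') 24 := by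
  obtain ⟨hX, hXLx, hBv, hSv, htop, hNyV, hPwV, hcDV, hLx, edd, eL, eK1, eLX, eLY, eK2, eper, eperY, eLK,
    elenX, elenY, eNy, eM1, eM2, eB0, eSVG, erho1, eSNVG, esig3, ethr, h12, hSVG, hSNVG, hL1, hA, hrho,
    hrs, hK2A, hLXA, hMK, hnrho, hnsig⟩ := g.facts hF
  have hLK : 1 ≤ g.LK := by omega
  unfold xGadget
  refine Achieves.seqs_cons (R := fun m₁ => m₁ 47 = r - g.K1 ∧ m₁ 48 = (r - g.K1) / g.LK ∧
      m₁ 49 = (r - g.K1) % g.LK ∧ m₁ 43 = (if (r - g.K1) % g.LK < g.L then 1 else 0) ∧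
      ∀ a, a ≠ 43 → a ≠ 47 → a ≠ 48 → a ≠ 49 → m₁ a = m a) (T₁ := 4) (T₂ := 20) ?_ ?_
  · refine achieves_block_of_eq (fun m' hm' => ?_) le_rfl
    simp (disch := first | omega | decide) only [execOps_cons, execOps_nil, execOp, Operand.write,
      Operand.read, merge_apply_of_lt, update_merge_of_lt, Function.update_self, Function.update_of_ne,
      BinOp.eval_sub_of_le, BinOp.eval_div, BinOp.eval_mod, BinOp.eval_lt, h46, h6, h26, h5] at hm'
    subst hm'
    refine ⟨?_, ?_, ?_, ?_, fun a h43 h47 h48 h49 => ?_⟩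
    any_goals simp (disch := first | omega | decide) only [merge_apply_of_lt, Function.update_self,
      Function.update_of_ne]
    by_cases h : a < 100
    · rw [merge_apply_of_lt h]; simp (disch := omega) only [Function.update_of_ne]
    · rw [merge_apply_of_le (by omega)]
  rintro m₁ ⟨q47, q48, q49, q43, qf⟩
  refine Achieves.seqs_cons (T₁ := 20) (T₂ := 0) ?_ (fun _ h => Achieves.seqs_nil h)
  refine Achieves.ifz (T := 18) (fun hz => ?_) (fun hnz => ?_)
  · -- `q ≥ L`: a block of `M₁`
    have hq : ¬ (r - g.K1) % g.LK < g.L := by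
      simp only [Operand.read, q43] at hz; intro h; simp [h] at hz
    have q20 : m₁ 20 = g.M1 := (qf 20 (by omega) (by omega) (by omega) (by omega)).trans h20
    refine achieves_block_of_eq (fun m' hm' => ?_) (by decide)
    simp (disch := first | omega | decide) only [execOps_cons, execOps_nil, execOp, Operand.write,
      Operand.read, merge_apply_of_lt, update_merge_of_lt, BinOp.eval_band, Nat.and_self, q20] at hm'
    subst hm'
    refine ⟨?_, fun a ha => ?_⟩
    · rw [merge_apply_of_lt (by omega), Function.update_self]; unfold nvgXtail; rw [if_neg hq]
    · by_cases h : a < 100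
      · rw [merge_apply_of_lt h, Function.update_of_ne (by omega), qf a (by omega) (by omega) (by omega) (by omega)]
      · rw [merge_apply_of_le (by omega), qf a (by omega) (by omega) (by omega) (by omega)]
  · -- `q < L`: the vector gadget
    have hq : (r - g.K1) % g.LK < g.L := by
      simp only [Operand.read, q43] at hnz; by_contra h; simp [h] at hnz
    have q45 : m₁ 45 = k := (qf 45 (by omega) (by omega) (by omega) (by omega)).trans h45
    have q3 : m₁ 3 = g.d := (qf 3 (by omega) (by omega) (by omega) (by omega)).trans h3
    have q2 : m₁ 2 = g.n := (qf 2 (by omega) (by omega) (by omega) (by omega)).trans h2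
    have q0 : m₁ 0 = g.X := (qf 0 (by omega) (by omega) (by omega) (by omega)).trans h0
    have qD : ∀ a, 100 ≤ a → a < g.Bv → m₁ a = relocated g.x a := fun a ha ha' => by
      rw [qf a (by omega) (by omega) (by omega) (by omega), hD a ha ha']
    refine (g.xVector_spec hF hn q49 q48 q45 q3 q2 q0 hq qD).mono (fun m₂ ⟨h53, hfr⟩ => ⟨?_, fun a ha => ?_⟩) le_rfl
    · rw [h53]; unfold nvgXtail; rw [if_pos hq]
    · rw [hfr a ha, qf a (by unfold XFrame at *; omega) (by omega) (by omega) (by omega)]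

/-- The value of the first curve past its first block. [folklore] -/
def ovXtail (p : ℕ) : ℕ :=
  if (p - g.K2) % g.per < g.LX then nvgXval g.I ((p - g.K2) / g.per % g.n) ((p - g.K2) % g.per) else g.M2

/-- **Past the leading block of the first curve** (`xRest`): from `r40 = p ≥ κ₂`, `r53 := ovXtail p`.
[folklore] -/
theorem xRest_spec (hF : g.Fits W) {m : ℕ → ℕ} {p : ℕ} (hR : g.Regs m) (h40 : m 40 = p)
    (hp : g.K2 ≤ p) (hpX : p < g.lenX) (hD : ∀ a, 100 ≤ a → a < g.Bv → m a = relocated g.x a) :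
    Achieves W O xRest m (fun m' => m' 53 = g.ovXtail p ∧ XFrame m m') 33 := by
  obtain ⟨hX, hXLx, hBv, hSv, htop, hNyV, hPwV, hcDV, hLx, edd, eL, eK1, eLX, eLY, eK2, eper, eperY, eLK,
    elenX, elenY, eNy, eM1, eM2, eB0, eSVG, erho1, eSNVG, esig3, ethr, h12, hSVG, hSNVG, hL1, hA, hrho,
    hrs, hK2A, hLXA, hMK, hnrho, hnsig⟩ := g.facts hF
  obtain ⟨r0, r2, r3, r4, r5, r6, r7, r8, r9, r10, r18, r19, r20, r21, r22, r23, r24, r25, r26, r27⟩ := hR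
  -- `n ≥ 1` since `p ≥ κ₂` is inside `|x| = κ₂ + 2 n per`
  have hn : 1 ≤ g.n := by
    rcases Nat.eq_zero_or_pos g.n with h | h
    · exfalso; rw [← elenX, h] at hpX; simp at hpX; omega
    · exact h
  have hper : 1 ≤ g.per := by omega
  unfold xRest
  refine Achieves.seqs_cons (R := fun m₁ => m₁ 44 = p - g.K2 ∧ m₁ 45 = (p - g.K2) / g.per ∧
      m₁ 46 = (p - g.K2) % g.per ∧ m₁ 43 = (if (p - g.K2) % g.per < g.LX then 1 else 0) ∧
      ∀ a, a ≠ 43 → a ≠ 44 → a ≠ 45 → a ≠ 46 → m₁ a = m a) (T₁ := 4) (T₂ := 29) ?_ ?_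
  · refine achieves_block_of_eq (fun m' hm' => ?_) le_rfl
    simp (disch := first | omega | decide) only [execOps_cons, execOps_nil, execOp, Operand.write,
      Operand.read, merge_apply_of_lt, update_merge_of_lt, Function.update_self, Function.update_of_ne,
      BinOp.eval_sub_of_le, BinOp.eval_div, BinOp.eval_mod, BinOp.eval_lt, h40, r9, r18, r7] at hm'
    subst hm'
    refine ⟨?_, ?_, ?_, ?_, fun a h43 h44 h45 h46 => ?_⟩
    any_goals simp (disch := first | omega | decide) only [merge_apply_of_lt, Function.update_self,
      Function.update_of_ne]
    by_cases h : a < 100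
    · rw [merge_apply_of_lt h]; simp (disch := omega) only [Function.update_of_ne]
    · rw [merge_apply_of_le (by omega)]
  rintro m₁ ⟨q44, q45, q46, q43, qf⟩
  refine Achieves.seqs_cons (T₁ := 29) (T₂ := 0) ?_ (fun _ h => Achieves.seqs_nil h)
  refine Achieves.ifz (T := 27) (fun hz => ?_) (fun hnz => ?_)
  · -- `r ≥ ℓx`: a block of `M₂`
    have hq : ¬ (p - g.K2) % g.per < g.LX := by
      simp only [Operand.read, q43] at hz; intro h; simp [h] at hz
    have q21 : m₁ 21 = g.M2 := (qf 21 (by omega) (by omega) (by omega) (by omega)).trans r21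
    refine achieves_block_of_eq (fun m' hm' => ?_) (by decide)
    simp (disch := first | omega | decide) only [execOps_cons, execOps_nil, execOp, Operand.write,
      Operand.read, merge_apply_of_lt, update_merge_of_lt, BinOp.eval_band, Nat.and_self, q21] at hm'
    subst hm'
    refine ⟨?_, fun a ha => ?_⟩
    · rw [merge_apply_of_lt (by omega), Function.update_self]; unfold ovXtail; rw [if_neg hq]
    · by_cases h : a < 100
      · rw [merge_apply_of_lt h, Function.update_of_ne (by omega), qf a (by omega) (by omega) (by omega) (by omega)]
      · rw [merge_apply_of_le (by omega), qf a (by omega) (by omega) (by omega) (by omega)]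
  · -- inside a gadget
    have hq : (p - g.K2) % g.per < g.LX := by
      simp only [Operand.read, q43] at hnz; by_contra h; simp [h] at hnz
    have q6 : m₁ 6 = g.K1 := (qf 6 (by omega) (by omega) (by omega) (by omega)).trans r6
    -- block: r43 := (r < κ₁)
    refine Achieves.seqs_cons (R := fun m₂ => m₂ 43 = (if (p - g.K2) % g.per < g.K1 then 1 else 0) ∧
        ∀ a, a ≠ 43 → m₂ a = m₁ a) (T₁ := 1) (T₂ := 26) ?_ ?_
    · refine achieves_block_of_eq (fun m' hm' => ?_) le_rfl
      simp (disch := first | omega | decide) only [execOps_cons, execOps_nil, execOp, Operand.write,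
        Operand.read, merge_apply_of_lt, update_merge_of_lt, BinOp.eval_lt, q46, q6] at hm'
      subst hm'
      refine ⟨by rw [merge_apply_of_lt (by omega), Function.update_self], fun a h43 => ?_⟩
      by_cases h : a < 100
      · rw [merge_apply_of_lt h, Function.update_of_ne h43]
      · rw [merge_apply_of_le (by omega)]
    rintro m₂ ⟨s43, sf⟩
    have sq : ∀ a, a ≠ 43 → a ≠ 44 → a ≠ 45 → a ≠ 46 → m₂ a = m a := fun a h1 h2 h3 h4 => by
      rw [sf a h1, qf a h1 h2 h3 h4]
    refine Achieves.seqs_cons (T₁ := 26) (T₂ := 0) ?_ (fun _ h => Achieves.seqs_nil h)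
    refine Achieves.ifz (T := 24) (fun hz' => ?_) (fun hnz' => ?_)
    · -- `r ≥ κ₁`: `xGadget`
      have hr : ¬ (p - g.K2) % g.per < g.K1 := by
        simp only [Operand.read, s43] at hz'; intro h; simp [h] at hz'
      have s46 : m₂ 46 = (p - g.K2) % g.per := by rw [sf 46 (by omega), q46]
      have s45 : m₂ 45 = (p - g.K2) / g.per := by rw [sf 45 (by omega), q45]
      refine (g.xGadget_spec hF hn s46 s45 ((sq 6 (by omega) (by omega) (by omega) (by omega)).trans r6)
        ((sq 26 (by omega) (by omega) (by omega) (by omega)).trans r26)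
        ((sq 5 (by omega) (by omega) (by omega) (by omega)).trans r5)
        ((sq 20 (by omega) (by omega) (by omega) (by omega)).trans r20)
        ((sq 3 (by omega) (by omega) (by omega) (by omega)).trans r3)
        ((sq 2 (by omega) (by omega) (by omega) (by omega)).trans r2)
        ((sq 0 (by omega) (by omega) (by omega) (by omega)).trans r0) (Nat.not_lt.1 hr) hq
        (fun a ha ha' => by rw [sq a (by omega) (by omega) (by omega) (by omega), hD a ha ha'])).mono
        (fun m₃ ⟨h53, hfr⟩ => ⟨?_, fun a ha => ?_⟩) le_rfl
      · rw [h53]; unfold ovXtail; rw [if_pos hq, nvgXval_eq, if_neg hr]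
      · rw [hfr a ha, sq a (by unfold XFrame at *; omega) (by omega) (by omega) (by omega)]
    · -- `r < κ₁`: a block of `M₁`
      have hr : (p - g.K2) % g.per < g.K1 := by
        simp only [Operand.read, s43] at hnz'; by_contra h; simp [h] at hnz'
      have s20 : m₂ 20 = g.M1 := (sq 20 (by omega) (by omega) (by omega) (by omega)).trans r20
      refine achieves_block_of_eq (fun m' hm' => ?_) (by decide)
      simp (disch := first | omega | decide) only [execOps_cons, execOps_nil, execOp, Operand.write,
        Operand.read, merge_apply_of_lt, update_merge_of_lt, BinOp.eval_band, Nat.and_self, s20] at hm'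
      subst hm'
      refine ⟨?_, fun a ha => ?_⟩
      · rw [merge_apply_of_lt (by omega), Function.update_self]
        unfold ovXtail; rw [if_pos hq, nvgXval_eq, if_pos hr]
      · by_cases h : a < 100
        · rw [merge_apply_of_lt h, Function.update_of_ne (by omega), sq a (by omega) (by omega) (by omega) (by omega)]
        · rw [merge_apply_of_le (by omega), sq a (by omega) (by omega) (by omega) (by omega)]


/-! ### The `x`-loop -/

/-- The invariant of the `x`-loop after `p` points. [folklore] -/
def XInv (p : ℕ) (m : ℕ → ℕ) : Prop :=
  g.Regs m ∧ g.ERegs m ∧ m 40 = p ∧ m 41 = g.lenX - p ∧ m 42 = g.Bv + 2 + p ∧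
    ∀ a, 100 ≤ a → m a = g.xData p a

/-- **The body of the `x`-loop**: one more point of the first curve. [folklore] -/
theorem xBody_spec (hF : g.Fits W) {p : ℕ} (hp : p < g.lenX) {m : ℕ → ℕ} (hI : g.XInv p m) :
    Achieves W O xBody m (g.XInv (p + 1)) 44 := by
  obtain ⟨hX, hXLx, hBv, hSv, htop, hNyV, hPwV, hcDV, hLx, edd, eL, eK1, eLX, eLY, eK2, eper, eperY, eLK,
    elenX, elenY, eNy, eM1, eM2, eB0, eSVG, erho1, eSNVG, esig3, ethr, h12, hSVG, hSNVG, hL1, hA, hrho,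
    hrs, hK2A, hLXA, hMK, hnrho, hnsig⟩ := g.facts hF
  obtain ⟨hR, hE, h40, h41, h42, hD⟩ := hI
  obtain ⟨r0, r2, r3, r4, r5, r6, r7, r8, r9, r10, r18, r19, r20, r21, r22, r23, r24, r25, r26, r27⟩ := hR
  obtain ⟨r11, r12, r13⟩ := hE
  have hval : ovXval g.I p ≤ g.M2 := ovXval_le g.I p hp
  have hPw1 : 1 ≤ g.Pw := Nat.one_le_two_pow
  unfold xBody
  -- the test `p < κ₂`
  refine Achieves.seqs_cons (R := fun m₁ => m₁ 43 = (if p < g.K2 then 1 else 0) ∧ ∀ a, a ≠ 43 → m₁ a = m a)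
    (T₁ := 1) (T₂ := 43) ?_ ?_
  · refine achieves_block_of_eq (fun m' hm' => ?_) le_rfl
    simp (disch := first | omega | decide) only [execOps_cons, execOps_nil, execOp, Operand.write,
      Operand.read, merge_apply_of_lt, update_merge_of_lt, BinOp.eval_lt, h40, r9] at hm'
    subst hm'
    refine ⟨by rw [merge_apply_of_lt (by omega), Function.update_self], fun a h43 => ?_⟩
    by_cases h : a < 100
    · rw [merge_apply_of_lt h, Function.update_of_ne h43]
    · rw [merge_apply_of_le (by omega)]
  rintro m₁ ⟨q43, qf⟩
  -- the point into `r53`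
  refine Achieves.seqs_cons (R := fun m₂ => m₂ 53 = ovXval g.I p ∧ XFrame m m₂) (T₁ := 35) (T₂ := 8) ?_ ?_
  · refine Achieves.ifz (T := 33) (fun hz => ?_) (fun hnz => ?_)
    · have hpK : ¬ p < g.K2 := by simp only [Operand.read, q43] at hz; intro h; simp [h] at hz
      have hR₁ : g.Regs m₁ := ⟨(qf 0 (by omega)).trans r0, (qf 2 (by omega)).trans r2, (qf 3 (by omega)).trans r3,
        (qf 4 (by omega)).trans r4, (qf 5 (by omega)).trans r5, (qf 6 (by omega)).trans r6,
        (qf 7 (by omega)).trans r7, (qf 8 (by omega)).trans r8, (qf 9 (by omega)).trans r9,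
        (qf 10 (by omega)).trans r10, (qf 18 (by omega)).trans r18, (qf 19 (by omega)).trans r19,
        (qf 20 (by omega)).trans r20, (qf 21 (by omega)).trans r21, (qf 22 (by omega)).trans r22,
        (qf 23 (by omega)).trans r23, (qf 24 (by omega)).trans r24, (qf 25 (by omega)).trans r25,
        (qf 26 (by omega)).trans r26, (qf 27 (by omega)).trans r27⟩
      refine (g.xRest_spec hF hR₁ ((qf 40 (by omega)).trans h40) (Nat.not_lt.1 hpK) hp
        (fun a ha ha' => by rw [qf a (by omega), hD a ha, g.xData_input p ha'])).mono
        (fun m₂ ⟨h53, hfr⟩ => ⟨?_, fun a ha => ?_⟩) le_rfl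
      · rw [h53, ovXval_eq, if_neg hpK]; rfl
      · rw [hfr a ha, qf a (by unfold XFrame at *; omega)]
    · have hpK : p < g.K2 := by simp only [Operand.read, q43] at hnz; by_contra h; simp [h] at hnz
      have q21 : m₁ 21 = g.M2 := (qf 21 (by omega)).trans r21
      refine achieves_block_of_eq (fun m' hm' => ?_) (by decide)
      simp (disch := first | omega | decide) only [execOps_cons, execOps_nil, execOp, Operand.write,
        Operand.read, merge_apply_of_lt, update_merge_of_lt, BinOp.eval_band, Nat.and_self, q21] at hm'
      subst hm'
      refine ⟨?_, fun a ha => ?_⟩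
      · rw [merge_apply_of_lt (by omega), Function.update_self, ovXval_eq, if_pos hpK]
      · by_cases h : a < 100
        · rw [merge_apply_of_lt h, Function.update_of_ne (by omega), qf a (by omega)]
        · rw [merge_apply_of_le (by omega), qf a (by omega)]
  -- the tail: double, reduce, store, advance
  rintro m₂ ⟨s53, sf⟩
  have s13 : m₂ 13 = g.Pw := (sf 13 (by omega)).trans r13
  have s42 : m₂ 42 = g.Bv + 2 + p := (sf 42 (by omega)).trans h42
  have s40 : m₂ 40 = p := (sf 40 (by omega)).trans h40
  have s41 : m₂ 41 = g.lenX - p := (sf 41 (by omega)).trans h41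
  refine Achieves.seqs_cons (T₁ := 8) (T₂ := 0) ?_ (fun _ h => Achieves.seqs_nil h)
  refine achieves_block_of_eq (fun m' hm' => ?_) (by decide)
  simp (disch := first | omega | decide) only [execOps_cons, execOps_nil, execOp, Operand.write,
    Operand.read, merge_apply_of_lt, update_merge_of_lt, update_merge_of_le, Function.update_self,
    Function.update_of_ne, BinOp.eval_add_of_lt, BinOp.eval_sub_of_le, BinOp.eval_mul_of_lt, BinOp.eval_mod,
    BinOp.eval_band, Nat.and_self, s53, s13, s42, s40, s41] at hm'
  subst hm'
  have hreg : ∀ a, a < 40 ∨ 55 < a → a < 100 →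
      merge (Function.update (Function.update (Function.update (Function.update (Function.update m₂ 53
        (ovXval g.I p * 2)) 53 (ovXval g.I p * 2 % g.Pw)) 42 (g.Bv + 2 + p + 1)) 40 (p + 1)) 41 (g.lenX - p - 1))
        (Function.update m₂ (g.Bv + 2 + p) (ovXval g.I p * 2 % g.Pw)) a = m a := by
    intro a ha ha'
    rw [merge_apply_of_lt ha']; simp (disch := omega) only [Function.update_of_ne]
    exact sf a (by unfold XFrame at *; omega)
  refine ⟨⟨?_, ?_, ?_, ?_, ?_, ?_, ?_, ?_, ?_, ?_, ?_, ?_, ?_, ?_, ?_, ?_, ?_, ?_, ?_, ?_⟩, ⟨?_, ?_, ?_⟩,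
    ?_, ?_, ?_, fun a ha => ?_⟩
  any_goals (rw [hreg _ (by omega) (by omega)]; assumption)
  · rw [merge_apply_of_lt (by omega)]; simp (disch := omega) only [Function.update_of_ne, Function.update_self]
  · rw [merge_apply_of_lt (by omega)]; simp (disch := omega) only [Function.update_self]; omega
  · rw [merge_apply_of_lt (by omega)]; simp (disch := omega) only [Function.update_of_ne, Function.update_self]; omega
  · rw [merge_apply_of_le ha, g.xData_succ]
    by_cases hb : a = g.Bv + 2 + p
    · subst hb; rw [Function.update_self, Function.update_self]; unfold xcell; rw [Nat.mul_comm]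
    · rw [Function.update_of_ne hb, Function.update_of_ne hb, sf a (by unfold XFrame at *; omega), hD a ha]

/-- **The `x`-loop**: all points of the first curve. [folklore] -/
theorem xLoop_spec (hF : g.Fits W) {m : ℕ → ℕ} (hR : g.Regs m) (hE : g.ERegs m)
    (hD : ∀ a, 100 ≤ a → m a = relocated g.x a) :
    Achieves W O xLoop m (g.XInv g.lenX) (3 + (g.lenX * (44 + 2) + 1)) := by
  obtain ⟨hX, hXLx, hBv, hSv, htop, hNyV, hPwV, hcDV, hLx, edd, eL, eK1, eLX, eLY, eK2, eper, eperY, eLK,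
    elenX, elenY, eNy, eM1, eM2, eB0, eSVG, erho1, eSNVG, esig3, ethr, h12, hSVG, hSNVG, hL1, hA, hrho,
    hrs, hK2A, hLXA, hMK, hnrho, hnsig⟩ := g.facts hF
  obtain ⟨r0, r2, r3, r4, r5, r6, r7, r8, r9, r10, r18, r19, r20, r21, r22, r23, r24, r25, r26, r27⟩ := hR
  obtain ⟨r11, r12, r13⟩ := hE
  unfold xLoop
  refine Achieves.mono (T := 3 + ((g.lenX * (44 + 2) + 1) + 0)) ?_ (fun _ h => h) (by omega)
  refine Achieves.seqs_cons (R := g.XInv 0) (T₁ := 3) ?_ ?_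
  · refine achieves_block_of_eq (fun m' hm' => ?_) le_rfl
    simp (disch := first | omega | decide) only [execOps_cons, execOps_nil, execOp, Operand.write,
      Operand.read, merge_apply_of_lt, update_merge_of_lt, Function.update_of_ne,
      BinOp.eval_add_of_lt, BinOp.eval_band, Nat.and_self, r22, r10] at hm'
    subst hm'
    have hreg : ∀ a, a ≠ 40 → a ≠ 41 → a ≠ 42 → a < 100 →
        merge (Function.update (Function.update (Function.update m 40 0) 41 g.lenX) 42 (g.Bv + 2)) m a = m a := by
      intro a h40 h41 h42 ha
      rw [merge_apply_of_lt ha]; simp (disch := omega) only [Function.update_of_ne]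
    refine ⟨⟨?_, ?_, ?_, ?_, ?_, ?_, ?_, ?_, ?_, ?_, ?_, ?_, ?_, ?_, ?_, ?_, ?_, ?_, ?_, ?_⟩, ⟨?_, ?_, ?_⟩,
      ?_, ?_, ?_, fun a ha => ?_⟩
    any_goals (rw [hreg _ (by omega) (by omega) (by omega) (by omega)]; assumption)
    · rw [merge_apply_of_lt (by omega)]; simp (disch := omega) only [Function.update_of_ne, Function.update_self]
    · rw [merge_apply_of_lt (by omega)]; simp (disch := omega) only [Function.update_of_ne, Function.update_self]; omega
    · rw [merge_apply_of_lt (by omega)]; simp (disch := omega) only [Function.update_self]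
    · rw [merge_apply_of_le ha, g.xData_zero, hD a ha]
  rintro m₁ h₁
  refine Achieves.seqs_cons (T₁ := g.lenX * (44 + 2) + 1) (T₂ := 0) ?_ (fun _ h => Achieves.seqs_nil h)
  refine Achieves.whilenz g.lenX 44 (fun p => g.XInv p)
    (fun p hp m' hI => ⟨?_, g.xBody_spec hF hp hI⟩) (fun m' hI => ?_) h₁ (fun _ h => h) le_rfl
  · simp only [Operand.read, hI.2.2.2.1]; omega
  · simp only [Operand.read, hI.2.2.2.1]; omega


/-! ### The `y`-loop: the decoding of one point -/

/-- The scratch registers of the `y`-loop body are `63–75`; a frame condition. [folklore] -/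
def YFrame (m m' : ℕ → ℕ) : Prop := ∀ a, a < 63 ∨ 75 < a → m' a = m a

/-- **The point of a `y`-side vector gadget** (`yPoint`): from `r69 = q`, `r71 = q mod 2`,
`r72 = b ≤ 1`, `r73 := 6 q + 2 - 2 ((q mod 2 xor 1) and b)`. [folklore] -/
theorem yPoint_spec (hF : g.Fits W) {m : ℕ → ℕ} {q b : ℕ} (h69 : m 69 = q) (h71 : m 71 = q % 2)
    (h72 : m 72 = b) (hb : b ≤ 1) (hq : q < g.LK) :
    Achieves W O yPoint m (fun m' => m' 73 = q * 6 + 2 - (((q % 2) ^^^ 1) &&& b) * 2 ∧ YFrame m m') 6 := by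
  obtain ⟨hX, hXLx, hBv, hSv, htop, hNyV, hPwV, hcDV, hLx, edd, eL, eK1, eLX, eLY, eK2, eper, eperY, eLK,
    elenX, elenY, eNy, eM1, eM2, eB0, eSVG, erho1, eSNVG, esig3, ethr, h12, hSVG, hSNVG, hL1, hA, hrho,
    hrs, hK2A, hLXA, hMK, hnrho, hnsig⟩ := g.facts hF
  have hW1 : 1 ≤ W := by have := hF.ws_lt; omega
  have h2W : 2 ≤ 2 ^ W := by
    calc (2 : ℕ) = 2 ^ 1 := rfl
      _ ≤ 2 ^ W := Nat.pow_le_pow_right (by norm_num) hW1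
  have hq2 : q % 2 < 2 := Nat.mod_lt _ (by norm_num)
  have hxor : (q % 2) ^^^ 1 ≤ 1 := by
    have := Nat.xor_lt_two_pow (n := 1) hq2 (by norm_num : 1 < 2 ^ 1); omega
  have hand : ((q % 2) ^^^ 1) &&& b ≤ 1 := (Nat.and_le_right).trans hb
  refine achieves_block_of_eq (fun m' hm' => ?_) le_rfl
  simp (disch := first | omega | decide) only [execOps_cons, execOps_nil, execOp, Operand.write,
    Operand.read, merge_apply_of_lt, update_merge_of_lt, Function.update_self, Function.update_of_ne,
    BinOp.eval_add_of_lt, BinOp.eval_sub_of_le, BinOp.eval_mul_of_lt, BinOp.eval_bxor_of_lt, BinOp.eval_band,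
    h69, h71, h72] at hm'
  subst hm'
  refine ⟨?_, fun a ha => ?_⟩
  · simp (disch := first | omega | decide) only [merge_apply_of_lt, Function.update_self]
  · by_cases h : a < 100
    · rw [merge_apply_of_lt h]; simp (disch := omega) only [Function.update_of_ne]
    · rw [merge_apply_of_le (by omega)]

/-- `j d + ℓ` addresses a `B`-bit. [folklore] -/
theorem mul_add_lt {j ℓ : ℕ} (hj : j < g.n) (hℓ : ℓ < g.d) : j * g.d + ℓ < g.n * g.d := by
  calc j * g.d + ℓ < j * g.d + g.d := by omega
    _ = (j + 1) * g.d := by ring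
    _ ≤ g.n * g.d := Nat.mul_le_mul_right _ hj

/-- **Inside the vector gadget of `bⱼ 1`** (`yVector`): from `r69 = q < L`, `r65 = j < n`, the
registers `d, B₀` and the relocated input below `Bv`, `r73 :=` the point `q` of the vector gadget
of `bⱼ 1`. [folklore] -/
theorem yVector_spec (hF : g.Fits W) {m : ℕ → ℕ} {q j : ℕ} (h69 : m 69 = q) (h65 : m 65 = j)
    (h3 : m 3 = g.d) (h27 : m 27 = g.B0) (hq : q < g.L) (hj : j < g.n)
    (hD : ∀ a, 100 ≤ a → a < g.Bv → m a = relocated g.x a) :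
    Achieves W O yVector m
      (fun m' => m' 73 = vgYval (fun ℓ => if ℓ < g.d then bbit g.I j ℓ else true) q ∧ YFrame m m') 16 := by
  obtain ⟨hX, hXLx, hBv, hSv, htop, hNyV, hPwV, hcDV, hLx, edd, eL, eK1, eLX, eLY, eK2, eper, eperY, eLK,
    elenX, elenY, eNy, eM1, eM2, eB0, eSVG, erho1, eSNVG, esig3, ethr, h12, hSVG, hSNVG, hL1, hA, hrho,
    hrs, hK2A, hLXA, hMK, hnrho, hnsig⟩ := g.facts hF
  have hqLK : q < g.LK := by omega
  unfold yVector
  -- block 1: ℓ, parity, the test `ℓ < d`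
  refine Achieves.seqs_cons (R := fun m₁ => m₁ 70 = q / 2 ∧ m₁ 71 = q % 2 ∧
      m₁ 63 = (if q / 2 < g.d then 1 else 0) ∧ ∀ a, a ≠ 63 → a ≠ 70 → a ≠ 71 → m₁ a = m a)
    (T₁ := 3) (T₂ := 13) ?_ ?_
  · refine achieves_block_of_eq (fun m' hm' => ?_) le_rfl
    simp (disch := first | omega | decide) only [execOps_cons, execOps_nil, execOp, Operand.write,
      Operand.read, merge_apply_of_lt, update_merge_of_lt, Function.update_self, Function.update_of_ne,
      BinOp.eval_div, BinOp.eval_mod, BinOp.eval_lt, h69, h3] at hm'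
    subst hm'
    refine ⟨?_, ?_, ?_, fun a h63 h70 h71 => ?_⟩
    any_goals simp (disch := first | omega | decide) only [merge_apply_of_lt, Function.update_self,
      Function.update_of_ne]
    by_cases h : a < 100
    · rw [merge_apply_of_lt h]; simp (disch := omega) only [Function.update_of_ne]
    · rw [merge_apply_of_le (by omega)]
  rintro m₁ ⟨q70, q71, q63, qf⟩
  have q69 : m₁ 69 = q := (qf 69 (by omega) (by omega) (by omega)).trans h69
  -- the bit
  refine Achieves.seqs_cons (R := fun m₂ => m₂ 72 = (if q / 2 < g.d then bbit g.I j (q / 2) else true).toNat ∧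
      m₂ 69 = q ∧ m₂ 71 = q % 2 ∧ ∀ a, a < 63 ∨ 75 < a → m₂ a = m a) (T₁ := 7) (T₂ := 6) ?_ ?_
  · refine Achieves.ifz (T := 5) (fun hz => ?_) (fun hnz => ?_)
    · -- `ℓ ≥ d`: bit `1`
      have hℓ : ¬ q / 2 < g.d := by simp only [Operand.read, q63] at hz; intro h; simp [h] at hz
      refine achieves_block_of_eq (fun m' hm' => ?_) (by decide)
      simp (disch := first | omega | decide) only [execOps_cons, execOps_nil, execOp, Operand.write,
        Operand.read, update_merge_of_lt, BinOp.eval_band, Nat.and_self] at hm'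
      subst hm'
      refine ⟨?_, ?_, ?_, fun a ha => ?_⟩
      · rw [merge_apply_of_lt (by omega), Function.update_self, if_neg hℓ]; rfl
      · rw [merge_apply_of_lt (by omega), Function.update_of_ne (by omega), q69]
      · rw [merge_apply_of_lt (by omega), Function.update_of_ne (by omega), q71]
      · by_cases h : a < 100
        · rw [merge_apply_of_lt h, Function.update_of_ne (by omega), qf a (by omega) (by omega) (by omega)]
        · rw [merge_apply_of_le (by omega), qf a (by omega) (by omega) (by omega)]
    · -- `ℓ < d`: read the input bit
      have hℓ : q / 2 < g.d := by simp only [Operand.read, q63] at hnz; by_contra h; simp [h] at hnz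
      have hlt := g.mul_add_lt hj hℓ
      have haddr : m₁ (j * g.d + q / 2 + g.B0) = (bbit g.I j (q / 2)).toNat := by
        rw [qf _ (by omega) (by omega) (by omega), hD _ (by omega) (by omega),
          show j * g.d + q / 2 + g.B0 = g.X + (2 + (g.n * g.d + (j * g.d + q / 2))) by omega,
          g.relocated_X_add, g.x_getD_B hj hℓ]
      have s65 : m₁ 65 = j := by rw [qf 65 (by omega) (by omega) (by omega), h65]
      have s3 : m₁ 3 = g.d := by rw [qf 3 (by omega) (by omega) (by omega), h3]
      have s27 : m₁ 27 = g.B0 := by rw [qf 27 (by omega) (by omega) (by omega), h27]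
      refine achieves_block_of_eq (fun m' hm' => ?_) (by decide)
      simp (disch := first | omega | decide) only [execOps_cons, execOps_nil, execOp, Operand.write,
        Operand.read, merge_apply_of_lt, merge_apply_of_le, update_merge_of_lt, Function.update_self,
        Function.update_of_ne, BinOp.eval_add_of_lt, BinOp.eval_mul_of_lt, BinOp.eval_band, Nat.and_self,
        s65, s3, s27, q70, haddr] at hm'
      subst hm'
      refine ⟨?_, ?_, ?_, fun a ha => ?_⟩
      · rw [merge_apply_of_lt (by omega), Function.update_self, if_pos hℓ]
      · rw [merge_apply_of_lt (by omega)]; simp (disch := omega) only [Function.update_of_ne]; exact q69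
      · rw [merge_apply_of_lt (by omega)]; simp (disch := omega) only [Function.update_of_ne]; exact q71
      · by_cases h : a < 100
        · rw [merge_apply_of_lt h]; simp (disch := omega) only [Function.update_of_ne]
          exact qf a (by omega) (by omega) (by omega)
        · rw [merge_apply_of_le (by omega), qf a (by omega) (by omega) (by omega)]
  -- the point
  rintro m₂ ⟨t72, t69, t71, tf⟩
  have hb : (if q / 2 < g.d then bbit g.I j (q / 2) else true).toNat ≤ 1 := Bool.toNat_le _
  refine Achieves.seqs_cons (T₁ := 6) (T₂ := 0) ?_ (fun _ h => Achieves.seqs_nil h)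
  refine (g.yPoint_spec hF t69 t71 t72 hb hqLK).mono (fun m₃ ⟨h73, hfr⟩ => ⟨?_, fun a ha => ?_⟩) le_rfl
  · rw [h73, (vgYval_eq _ q).1]
  · rw [hfr a (by unfold YFrame at *; omega), tf a ha]

/-- The value of a `y`-side normalised vector gadget past its first block. [folklore] -/
def nvgYtail (j r : ℕ) : ℕ :=
  if (r - g.K1) % g.LK < g.L then vgYval (fun ℓ => if ℓ < g.d then bbit g.I j ℓ else true) ((r - g.K1) % g.LK)
  else g.M1

/-- `nvgYval` in terms of `nvgYtail`. [folklore] -/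
theorem nvgYval_eq (j r : ℕ) : nvgYval g.I j r = if r < g.K1 then g.M1 else g.nvgYtail j r := rfl

/-- `ovYval` in the program's terms. [folklore] -/
theorem ovYval_eq (q : ℕ) : ovYval g.I q = if q < g.K2 then g.M2 else
    if (q - g.K2) % g.perY < g.LY then nvgYval g.I ((q - g.K2) / g.perY) ((q - g.K2) % g.perY)
    else g.M2 := rfl

/-- **Inside a `y`-side normalised vector gadget** (`yGadget`): from `r66 = r ≥ κ₁`, `r65 = j`,
`r73 := nvgYtail j r`. [folklore] -/
theorem yGadget_spec (hF : g.Fits W) {m : ℕ → ℕ} {r j : ℕ} (h66 : m 66 = r) (h65 : m 65 = j)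
    (h6 : m 6 = g.K1) (h26 : m 26 = g.LK) (h5 : m 5 = g.L) (h20 : m 20 = g.M1) (h3 : m 3 = g.d)
    (h27 : m 27 = g.B0) (hr : g.K1 ≤ r) (hrY : r < g.LY) (hj : j < g.n)
    (hD : ∀ a, 100 ≤ a → a < g.Bv → m a = relocated g.x a) :
    Achieves W O yGadget m (fun m' => m' 73 = g.nvgYtail j r ∧ YFrame m m') 21 := by
  obtain ⟨hX, hXLx, hBv, hSv, htop, hNyV, hPwV, hcDV, hLx, edd, eL, eK1, eLX, eLY, eK2, eper, eperY, eLK,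
    elenX, elenY, eNy, eM1, eM2, eB0, eSVG, erho1, eSNVG, esig3, ethr, h12, hSVG, hSNVG, hL1, hA, hrho,
    hrs, hK2A, hLXA, hMK, hnrho, hnsig⟩ := g.facts hF
  have hLK : 1 ≤ g.LK := by omega
  unfold yGadget
  refine Achieves.seqs_cons (R := fun m₁ => m₁ 67 = r - g.K1 ∧ m₁ 69 = (r - g.K1) % g.LK ∧
      m₁ 63 = (if (r - g.K1) % g.LK < g.L then 1 else 0) ∧
      ∀ a, a ≠ 63 → a ≠ 67 → a ≠ 69 → m₁ a = m a) (T₁ := 3) (T₂ := 18) ?_ ?_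
  · refine achieves_block_of_eq (fun m' hm' => ?_) le_rfl
    simp (disch := first | omega | decide) only [execOps_cons, execOps_nil, execOp, Operand.write,
      Operand.read, merge_apply_of_lt, update_merge_of_lt, Function.update_self, Function.update_of_ne,
      BinOp.eval_sub_of_le, BinOp.eval_mod, BinOp.eval_lt, h66, h6, h26, h5] at hm'
    subst hm'
    refine ⟨?_, ?_, ?_, fun a h63 h67 h69 => ?_⟩
    any_goals simp (disch := first | omega | decide) only [merge_apply_of_lt, Function.update_self,
      Function.update_of_ne]
    by_cases h : a < 100
    · rw [merge_apply_of_lt h]; simp (disch := omega) only [Function.update_of_ne]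
    · rw [merge_apply_of_le (by omega)]
  rintro m₁ ⟨q67, q69, q63, qf⟩
  refine Achieves.seqs_cons (T₁ := 18) (T₂ := 0) ?_ (fun _ h => Achieves.seqs_nil h)
  refine Achieves.ifz (T := 16) (fun hz => ?_) (fun hnz => ?_)
  · have hq : ¬ (r - g.K1) % g.LK < g.L := by simp only [Operand.read, q63] at hz; intro h; simp [h] at hz
    have q20 : m₁ 20 = g.M1 := (qf 20 (by omega) (by omega) (by omega)).trans h20
    refine achieves_block_of_eq (fun m' hm' => ?_) (by decide)
    simp (disch := first | omega | decide) only [execOps_cons, execOps_nil, execOp, Operand.write,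
      Operand.read, merge_apply_of_lt, update_merge_of_lt, BinOp.eval_band, Nat.and_self, q20] at hm'
    subst hm'
    refine ⟨?_, fun a ha => ?_⟩
    · rw [merge_apply_of_lt (by omega), Function.update_self]; unfold nvgYtail; rw [if_neg hq]
    · by_cases h : a < 100
      · rw [merge_apply_of_lt h, Function.update_of_ne (by omega), qf a (by omega) (by omega) (by omega)]
      · rw [merge_apply_of_le (by omega), qf a (by omega) (by omega) (by omega)]
  · have hq : (r - g.K1) % g.LK < g.L := by simp only [Operand.read, q63] at hnz; by_contra h; simp [h] at hnz
    have q65 : m₁ 65 = j := (qf 65 (by omega) (by omega) (by omega)).trans h65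
    have q3 : m₁ 3 = g.d := (qf 3 (by omega) (by omega) (by omega)).trans h3
    have q27 : m₁ 27 = g.B0 := (qf 27 (by omega) (by omega) (by omega)).trans h27
    have qD : ∀ a, 100 ≤ a → a < g.Bv → m₁ a = relocated g.x a := fun a ha ha' => by
      rw [qf a (by omega) (by omega) (by omega), hD a ha ha']
    refine (g.yVector_spec hF q69 q65 q3 q27 hq hj qD).mono (fun m₂ ⟨h73, hfr⟩ => ⟨?_, fun a ha => ?_⟩) le_rfl
    · rw [h73]; unfold nvgYtail; rw [if_pos hq]
    · rw [hfr a ha, qf a (by unfold YFrame at *; omega) (by omega) (by omega)]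

/-- The value of the second curve past its first block. [folklore] -/
def ovYtail (q : ℕ) : ℕ :=
  if (q - g.K2) % g.perY < g.LY then nvgYval g.I ((q - g.K2) / g.perY) ((q - g.K2) % g.perY) else g.M2

/-- **Past the leading block of the second curve** (`yRest`): from `r60 = q ≥ κ₂`, `r73 := ovYtail q`.
[folklore] -/
theorem yRest_spec (hF : g.Fits W) {m : ℕ → ℕ} {q : ℕ} (hR : g.Regs m) (h60 : m 60 = q)
    (hq : g.K2 ≤ q) (hqY : q < g.lenY) (hD : ∀ a, 100 ≤ a → a < g.Bv → m a = relocated g.x a) :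
    Achieves W O yRest m (fun m' => m' 73 = g.ovYtail q ∧ YFrame m m') 30 := by
  obtain ⟨hX, hXLx, hBv, hSv, htop, hNyV, hPwV, hcDV, hLx, edd, eL, eK1, eLX, eLY, eK2, eper, eperY, eLK,
    elenX, elenY, eNy, eM1, eM2, eB0, eSVG, erho1, eSNVG, esig3, ethr, h12, hSVG, hSNVG, hL1, hA, hrho,
    hrs, hK2A, hLXA, hMK, hnrho, hnsig⟩ := g.facts hF
  obtain ⟨r0, r2, r3, r4, r5, r6, r7, r8, r9, r10, r18, r19, r20, r21, r22, r23, r24, r25, r26, r27⟩ := hR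
  have hperY : 1 ≤ g.perY := by omega
  have hj : (q - g.K2) / g.perY < g.n := by
    apply Nat.div_lt_of_lt_mul; rw [← elenY] at hqY
    have : g.perY * g.n = g.n * g.perY := Nat.mul_comm _ _
    omega
  unfold yRest
  refine Achieves.seqs_cons (R := fun m₁ => m₁ 64 = q - g.K2 ∧ m₁ 65 = (q - g.K2) / g.perY ∧
      m₁ 66 = (q - g.K2) % g.perY ∧ m₁ 63 = (if (q - g.K2) % g.perY < g.LY then 1 else 0) ∧
      ∀ a, a ≠ 63 → a ≠ 64 → a ≠ 65 → a ≠ 66 → m₁ a = m a) (T₁ := 4) (T₂ := 26) ?_ ?_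
  · refine achieves_block_of_eq (fun m' hm' => ?_) le_rfl
    simp (disch := first | omega | decide) only [execOps_cons, execOps_nil, execOp, Operand.write,
      Operand.read, merge_apply_of_lt, update_merge_of_lt, Function.update_self, Function.update_of_ne,
      BinOp.eval_sub_of_le, BinOp.eval_div, BinOp.eval_mod, BinOp.eval_lt, h60, r9, r19, r8] at hm'
    subst hm'
    refine ⟨?_, ?_, ?_, ?_, fun a h63 h64 h65 h66 => ?_⟩
    any_goals simp (disch := first | omega | decide) only [merge_apply_of_lt, Function.update_self,
      Function.update_of_ne]
    by_cases h : a < 100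
    · rw [merge_apply_of_lt h]; simp (disch := omega) only [Function.update_of_ne]
    · rw [merge_apply_of_le (by omega)]
  rintro m₁ ⟨q64, q65, q66, q63, qf⟩
  refine Achieves.seqs_cons (T₁ := 26) (T₂ := 0) ?_ (fun _ h => Achieves.seqs_nil h)
  refine Achieves.ifz (T := 24) (fun hz => ?_) (fun hnz => ?_)
  · have hq' : ¬ (q - g.K2) % g.perY < g.LY := by simp only [Operand.read, q63] at hz; intro h; simp [h] at hz
    have q21 : m₁ 21 = g.M2 := (qf 21 (by omega) (by omega) (by omega) (by omega)).trans r21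
    refine achieves_block_of_eq (fun m' hm' => ?_) (by decide)
    simp (disch := first | omega | decide) only [execOps_cons, execOps_nil, execOp, Operand.write,
      Operand.read, merge_apply_of_lt, update_merge_of_lt, BinOp.eval_band, Nat.and_self, q21] at hm'
    subst hm'
    refine ⟨?_, fun a ha => ?_⟩
    · rw [merge_apply_of_lt (by omega), Function.update_self]; unfold ovYtail; rw [if_neg hq']
    · by_cases h : a < 100
      · rw [merge_apply_of_lt h, Function.update_of_ne (by omega), qf a (by omega) (by omega) (by omega) (by omega)]
      · rw [merge_apply_of_le (by omega), qf a (by omega) (by omega) (by omega) (by omega)]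
  · have hq' : (q - g.K2) % g.perY < g.LY := by simp only [Operand.read, q63] at hnz; by_contra h; simp [h] at hnz
    have q6 : m₁ 6 = g.K1 := (qf 6 (by omega) (by omega) (by omega) (by omega)).trans r6
    refine Achieves.seqs_cons (R := fun m₂ => m₂ 63 = (if (q - g.K2) % g.perY < g.K1 then 1 else 0) ∧
        ∀ a, a ≠ 63 → m₂ a = m₁ a) (T₁ := 1) (T₂ := 23) ?_ ?_
    · refine achieves_block_of_eq (fun m' hm' => ?_) le_rfl
      simp (disch := first | omega | decide) only [execOps_cons, execOps_nil, execOp, Operand.write,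
        Operand.read, merge_apply_of_lt, update_merge_of_lt, BinOp.eval_lt, q66, q6] at hm'
      subst hm'
      refine ⟨by rw [merge_apply_of_lt (by omega), Function.update_self], fun a h63 => ?_⟩
      by_cases h : a < 100
      · rw [merge_apply_of_lt h, Function.update_of_ne h63]
      · rw [merge_apply_of_le (by omega)]
    rintro m₂ ⟨s63, sf⟩
    have sq : ∀ a, a ≠ 63 → a ≠ 64 → a ≠ 65 → a ≠ 66 → m₂ a = m a := fun a h1 h2 h3 h4 => by
      rw [sf a h1, qf a h1 h2 h3 h4]
    refine Achieves.seqs_cons (T₁ := 23) (T₂ := 0) ?_ (fun _ h => Achieves.seqs_nil h)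
    refine Achieves.ifz (T := 21) (fun hz' => ?_) (fun hnz' => ?_)
    · have hr : ¬ (q - g.K2) % g.perY < g.K1 := by simp only [Operand.read, s63] at hz'; intro h; simp [h] at hz'
      have s66 : m₂ 66 = (q - g.K2) % g.perY := by rw [sf 66 (by omega), q66]
      have s65 : m₂ 65 = (q - g.K2) / g.perY := by rw [sf 65 (by omega), q65]
      refine (g.yGadget_spec hF s66 s65 ((sq 6 (by omega) (by omega) (by omega) (by omega)).trans r6)
        ((sq 26 (by omega) (by omega) (by omega) (by omega)).trans r26)
        ((sq 5 (by omega) (by omega) (by omega) (by omega)).trans r5)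
        ((sq 20 (by omega) (by omega) (by omega) (by omega)).trans r20)
        ((sq 3 (by omega) (by omega) (by omega) (by omega)).trans r3)
        ((sq 27 (by omega) (by omega) (by omega) (by omega)).trans r27) (Nat.not_lt.1 hr) hq' hj
        (fun a ha ha' => by rw [sq a (by omega) (by omega) (by omega) (by omega), hD a ha ha'])).mono
        (fun m₃ ⟨h73, hfr⟩ => ⟨?_, fun a ha => ?_⟩) le_rfl
      · rw [h73]; unfold ovYtail; rw [if_pos hq', nvgYval_eq, if_neg hr]
      · rw [hfr a ha, sq a (by unfold YFrame at *; omega) (by omega) (by omega) (by omega)]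
    · have hr : (q - g.K2) % g.perY < g.K1 := by simp only [Operand.read, s63] at hnz'; by_contra h; simp [h] at hnz'
      have s20 : m₂ 20 = g.M1 := (sq 20 (by omega) (by omega) (by omega) (by omega)).trans r20
      refine achieves_block_of_eq (fun m' hm' => ?_) (by decide)
      simp (disch := first | omega | decide) only [execOps_cons, execOps_nil, execOp, Operand.write,
        Operand.read, merge_apply_of_lt, update_merge_of_lt, BinOp.eval_band, Nat.and_self, s20] at hm'
      subst hm'
      refine ⟨?_, fun a ha => ?_⟩
      · rw [merge_apply_of_lt (by omega), Function.update_self]; unfold ovYtail; rw [if_pos hq', nvgYval_eq, if_pos hr]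
      · by_cases h : a < 100
        · rw [merge_apply_of_lt h, Function.update_of_ne (by omega), sq a (by omega) (by omega) (by omega) (by omega)]
        · rw [merge_apply_of_le (by omega), sq a (by omega) (by omega) (by omega) (by omega)]


/-! ### The `y`-loop -/

/-- The invariant of the `y`-loop after `q` points. [folklore] -/
def YInv (q : ℕ) (m : ℕ → ℕ) : Prop :=
  g.Regs m ∧ g.ERegs m ∧ m 60 = q ∧ m 61 = g.lenY - q ∧ m 62 = g.Bv + 2 + g.lenX + q ∧
    ∀ a, 100 ≤ a → m a = g.yData q a

/-- **The body of the `y`-loop**: one more point of the second curve. [folklore] -/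
theorem yBody_spec (hF : g.Fits W) {q : ℕ} (hq : q < g.lenY) {m : ℕ → ℕ} (hI : g.YInv q m) :
    Achieves W O yBody m (g.YInv (q + 1)) 41 := by
  obtain ⟨hX, hXLx, hBv, hSv, htop, hNyV, hPwV, hcDV, hLx, edd, eL, eK1, eLX, eLY, eK2, eper, eperY, eLK,
    elenX, elenY, eNy, eM1, eM2, eB0, eSVG, erho1, eSNVG, esig3, ethr, h12, hSVG, hSNVG, hL1, hA, hrho,
    hrs, hK2A, hLXA, hMK, hnrho, hnsig⟩ := g.facts hF
  obtain ⟨hR, hE, h60, h61, h62, hD⟩ := hI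
  obtain ⟨r0, r2, r3, r4, r5, r6, r7, r8, r9, r10, r18, r19, r20, r21, r22, r23, r24, r25, r26, r27⟩ := hR
  obtain ⟨r11, r12, r13⟩ := hE
  have hval : ovYval g.I q ≤ g.M2 := ovYval_le g.I q hq
  have hPw1 : 1 ≤ g.Pw := Nat.one_le_two_pow
  unfold yBody
  refine Achieves.seqs_cons (R := fun m₁ => m₁ 63 = (if q < g.K2 then 1 else 0) ∧ ∀ a, a ≠ 63 → m₁ a = m a)
    (T₁ := 1) (T₂ := 40) ?_ ?_
  · refine achieves_block_of_eq (fun m' hm' => ?_) le_rfl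
    simp (disch := first | omega | decide) only [execOps_cons, execOps_nil, execOp, Operand.write,
      Operand.read, merge_apply_of_lt, update_merge_of_lt, BinOp.eval_lt, h60, r9] at hm'
    subst hm'
    refine ⟨by rw [merge_apply_of_lt (by omega), Function.update_self], fun a h63 => ?_⟩
    by_cases h : a < 100
    · rw [merge_apply_of_lt h, Function.update_of_ne h63]
    · rw [merge_apply_of_le (by omega)]
  rintro m₁ ⟨q63, qf⟩
  refine Achieves.seqs_cons (R := fun m₂ => m₂ 73 = ovYval g.I q ∧ YFrame m m₂) (T₁ := 32) (T₂ := 8) ?_ ?_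
  · refine Achieves.ifz (T := 30) (fun hz => ?_) (fun hnz => ?_)
    · have hqK : ¬ q < g.K2 := by simp only [Operand.read, q63] at hz; intro h; simp [h] at hz
      have hR₁ : g.Regs m₁ := ⟨(qf 0 (by omega)).trans r0, (qf 2 (by omega)).trans r2, (qf 3 (by omega)).trans r3,
        (qf 4 (by omega)).trans r4, (qf 5 (by omega)).trans r5, (qf 6 (by omega)).trans r6,
        (qf 7 (by omega)).trans r7, (qf 8 (by omega)).trans r8, (qf 9 (by omega)).trans r9,
        (qf 10 (by omega)).trans r10, (qf 18 (by omega)).trans r18, (qf 19 (by omega)).trans r19,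
        (qf 20 (by omega)).trans r20, (qf 21 (by omega)).trans r21, (qf 22 (by omega)).trans r22,
        (qf 23 (by omega)).trans r23, (qf 24 (by omega)).trans r24, (qf 25 (by omega)).trans r25,
        (qf 26 (by omega)).trans r26, (qf 27 (by omega)).trans r27⟩
      refine (g.yRest_spec hF hR₁ ((qf 60 (by omega)).trans h60) (Nat.not_lt.1 hqK) hq
        (fun a ha ha' => by rw [qf a (by omega), hD a ha, g.yData_input q ha'])).mono
        (fun m₂ ⟨h73, hfr⟩ => ⟨?_, fun a ha => ?_⟩) le_rfl
      · rw [h73, ovYval_eq, if_neg hqK]; rfl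
      · rw [hfr a ha, qf a (by unfold YFrame at *; omega)]
    · have hqK : q < g.K2 := by simp only [Operand.read, q63] at hnz; by_contra h; simp [h] at hnz
      have q21 : m₁ 21 = g.M2 := (qf 21 (by omega)).trans r21
      refine achieves_block_of_eq (fun m' hm' => ?_) (by decide)
      simp (disch := first | omega | decide) only [execOps_cons, execOps_nil, execOp, Operand.write,
        Operand.read, merge_apply_of_lt, update_merge_of_lt, BinOp.eval_band, Nat.and_self, q21] at hm'
      subst hm'
      refine ⟨?_, fun a ha => ?_⟩
      · rw [merge_apply_of_lt (by omega), Function.update_self, ovYval_eq, if_pos hqK]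
      · by_cases h : a < 100
        · rw [merge_apply_of_lt h, Function.update_of_ne (by omega), qf a (by omega)]
        · rw [merge_apply_of_le (by omega), qf a (by omega)]
  rintro m₂ ⟨s73, sf⟩
  have s13 : m₂ 13 = g.Pw := (sf 13 (by omega)).trans r13
  have s62 : m₂ 62 = g.Bv + 2 + g.lenX + q := (sf 62 (by omega)).trans h62
  have s60 : m₂ 60 = q := (sf 60 (by omega)).trans h60
  have s61 : m₂ 61 = g.lenY - q := (sf 61 (by omega)).trans h61
  refine Achieves.seqs_cons (T₁ := 8) (T₂ := 0) ?_ (fun _ h => Achieves.seqs_nil h)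
  refine achieves_block_of_eq (fun m' hm' => ?_) (by decide)
  simp (disch := first | omega | decide) only [execOps_cons, execOps_nil, execOp, Operand.write,
    Operand.read, merge_apply_of_lt, update_merge_of_lt, update_merge_of_le, Function.update_self,
    Function.update_of_ne, BinOp.eval_add_of_lt, BinOp.eval_sub_of_le, BinOp.eval_mul_of_lt, BinOp.eval_mod,
    BinOp.eval_band, Nat.and_self, s73, s13, s62, s60, s61] at hm'
  subst hm'
  have hreg : ∀ a, a < 60 ∨ 75 < a → a < 100 →
      merge (Function.update (Function.update (Function.update (Function.update (Function.update m₂ 73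
        (ovYval g.I q * 2)) 73 (ovYval g.I q * 2 % g.Pw)) 62 (g.Bv + 2 + g.lenX + q + 1)) 60 (q + 1)) 61 (g.lenY - q - 1))
        (Function.update m₂ (g.Bv + 2 + g.lenX + q) (ovYval g.I q * 2 % g.Pw)) a = m a := by
    intro a ha ha'
    rw [merge_apply_of_lt ha']; simp (disch := omega) only [Function.update_of_ne]
    exact sf a (by unfold YFrame at *; omega)
  refine ⟨⟨?_, ?_, ?_, ?_, ?_, ?_, ?_, ?_, ?_, ?_, ?_, ?_, ?_, ?_, ?_, ?_, ?_, ?_, ?_, ?_⟩, ⟨?_, ?_, ?_⟩,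
    ?_, ?_, ?_, fun a ha => ?_⟩
  any_goals (rw [hreg _ (by omega) (by omega)]; assumption)
  · rw [merge_apply_of_lt (by omega)]; simp (disch := omega) only [Function.update_of_ne, Function.update_self]
  · rw [merge_apply_of_lt (by omega)]; simp (disch := omega) only [Function.update_self]; omega
  · rw [merge_apply_of_lt (by omega)]; simp (disch := omega) only [Function.update_of_ne, Function.update_self]; omega
  · rw [merge_apply_of_le ha, g.yData_succ]
    by_cases hb : a = g.Bv + 2 + g.lenX + q
    · subst hb; rw [Function.update_self, Function.update_self]; unfold ycellY; rw [Nat.mul_comm]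
    · rw [Function.update_of_ne hb, Function.update_of_ne hb, sf a (by unfold YFrame at *; omega), hD a ha]

/-- **The `y`-loop**: all points of the second curve, after the `x`-loop. [folklore] -/
theorem yLoop_spec (hF : g.Fits W) {m : ℕ → ℕ} (hI : g.XInv g.lenX m) :
    Achieves W O yLoop m (g.YInv g.lenY) (4 + ((g.lenY * (41 + 2) + 1) + 0)) := by
  obtain ⟨hX, hXLx, hBv, hSv, htop, hNyV, hPwV, hcDV, hLx, edd, eL, eK1, eLX, eLY, eK2, eper, eperY, eLK,
    elenX, elenY, eNy, eM1, eM2, eB0, eSVG, erho1, eSNVG, esig3, ethr, h12, hSVG, hSNVG, hL1, hA, hrho,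
    hrs, hK2A, hLXA, hMK, hnrho, hnsig⟩ := g.facts hF
  obtain ⟨hR, hE, -, -, -, hD⟩ := hI
  obtain ⟨r0, r2, r3, r4, r5, r6, r7, r8, r9, r10, r18, r19, r20, r21, r22, r23, r24, r25, r26, r27⟩ := hR
  obtain ⟨r11, r12, r13⟩ := hE
  unfold yLoop
  refine Achieves.seqs_cons (R := g.YInv 0) (T₁ := 4) ?_ ?_
  · refine achieves_block_of_eq (fun m' hm' => ?_) le_rfl
    simp (disch := first | omega | decide) only [execOps_cons, execOps_nil, execOp, Operand.write,
      Operand.read, merge_apply_of_lt, update_merge_of_lt, Function.update_self, Function.update_of_ne,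
      BinOp.eval_add_of_lt, BinOp.eval_band, Nat.and_self, r23, r10, r22] at hm'
    subst hm'
    have hreg : ∀ a, a ≠ 60 → a ≠ 61 → a ≠ 62 → a < 100 →
        merge (Function.update (Function.update (Function.update (Function.update m 60 0) 61 g.lenY) 62 (g.Bv + 2))
          62 (g.Bv + 2 + g.lenX)) m a = m a := by
      intro a h60 h61 h62 ha
      rw [merge_apply_of_lt ha]; simp (disch := omega) only [Function.update_of_ne]
    refine ⟨⟨?_, ?_, ?_, ?_, ?_, ?_, ?_, ?_, ?_, ?_, ?_, ?_, ?_, ?_, ?_, ?_, ?_, ?_, ?_, ?_⟩, ⟨?_, ?_, ?_⟩,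
      ?_, ?_, ?_, fun a ha => ?_⟩
    any_goals (rw [hreg _ (by omega) (by omega) (by omega) (by omega)]; assumption)
    · rw [merge_apply_of_lt (by omega)]; simp (disch := omega) only [Function.update_of_ne, Function.update_self]
    · rw [merge_apply_of_lt (by omega)]; simp (disch := omega) only [Function.update_of_ne, Function.update_self]; omega
    · rw [merge_apply_of_lt (by omega)]; simp (disch := omega) only [Function.update_self]; omega
    · rw [merge_apply_of_le ha, g.yData_zero, hD a ha]
  rintro m₁ h₁
  refine Achieves.seqs_cons (T₁ := g.lenY * (41 + 2) + 1) (T₂ := 0) ?_ (fun _ h => Achieves.seqs_nil h)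
  refine Achieves.whilenz g.lenY 41 (fun q => g.YInv q)
    (fun q hq m' hI => ⟨?_, g.yBody_spec hF hq hI⟩) (fun m' hI => ?_) h₁ (fun _ h => h) le_rfl
  · simp only [Operand.read, hI.2.2.2.1]; omega
  · simp only [Operand.read, hI.2.2.2.1]; omega


/-! ### The final data -/

/-- Emulated cell `j` of the initial memory of the DTW program on `y = dtwInput I` (word size
`ws`): `|y| = Ny` in cell `0`, `y[j - 1]` in cell `j`, reduced modulo `Pw`, `0` past the input.
[folklore] -/
noncomputable def ycell (j : ℕ) : ℕ :=
  if j = 0 then g.Ny % g.Pw else (g.y.getD (j - 1) 0) % g.Pw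

/-- The final data: the relocated input and the emulated input. [folklore] -/
noncomputable def finData (a : ℕ) : ℕ :=
  if a < g.Bv then relocated g.x a
  else if a < g.Bv + (g.Ny + 1) then g.ycell (a - g.Bv)
  else 0

/-- **The final memory of the build**: registers `10–13` hold `Bv, Sv, 0, Pw`, register `25` the
threshold `thr'`, every other register is `0`, and the data is `finData`. [folklore] -/
noncomputable def finMem (a : ℕ) : ℕ :=
  if a < 100 then (if a = 10 then g.Bv else if a = 11 then g.Sv else if a = 13 then g.Pw
    else if a = 25 then g.thr' else 0)
  else g.finData a

/-- The length of the emulated input is `Ny`. [folklore] -/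
theorem length_y : g.y.length = g.Ny := length_dtwInput g.I

/-- The cells `2 + p` of the emulated input: the first curve. [folklore] -/
theorem ycell_x {p : ℕ} (hp : p < g.lenX) : g.ycell (2 + p) = g.xcell p := by
  unfold ycell xcell y
  rw [if_neg (by omega), show 2 + p - 1 = 1 + p by omega, dtwInput_getD, if_neg (by omega),
    if_pos (by show 1 + p - 1 < (ovX g.I).length; unfold lenX at hp; omega), show 1 + p - 1 = p by omega]

/-- The cells `2 + |x| + q` of the emulated input: the second curve. [folklore] -/
theorem ycell_y {q : ℕ} (hq : q < g.lenY) : g.ycell (2 + g.lenX + q) = g.ycellY q := by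
  unfold ycell ycellY y lenX
  unfold lenY at hq
  rw [if_neg (by omega), show 2 + (ovX g.I).length + q - 1 = 1 + (ovX g.I).length + q by omega, dtwInput_getD,
    if_neg (by omega), if_neg (by omega), if_pos (by omega),
    show 1 + (ovX g.I).length + q - 1 - (ovX g.I).length = q by omega]

/-- Cell `1` of the emulated input: `|x|`. [folklore] -/
theorem ycell_one : g.ycell 1 = g.lenX % g.Pw := by
  unfold ycell y lenX; rw [if_neg (by omega), dtwInput_getD, if_pos rfl]

/-- Cell `0` of the emulated input: `Ny`. [folklore] -/
theorem ycell_zero : g.ycell 0 = g.Ny % g.Pw := by unfold ycell; rw [if_pos rfl]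

/-- The header turns the data of the loops into the final data. [folklore] -/
theorem finData_header {m : ℕ → ℕ} (hm : ∀ a, 100 ≤ a → m a = g.yData g.lenY a) (a : ℕ) (ha : 100 ≤ a) :
    Function.update (Function.update m g.Bv (g.Ny % g.Pw)) (g.Bv + 1) (g.lenX % g.Pw) a = g.finData a := by
  obtain ⟨hX, -, hBv, -⟩ := g.bases
  have hNy : g.lenX + g.lenY + 1 = g.Ny := rfl
  unfold finData
  by_cases h1 : a = g.Bv + 1
  · subst h1; rw [Function.update_self, if_neg (by omega), if_pos (by omega), Nat.add_sub_cancel_left, ycell_one]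
  rw [Function.update_of_ne h1]
  by_cases h0 : a = g.Bv
  · subst h0; rw [Function.update_self, if_neg (by omega), if_pos (by omega), Nat.sub_self, ycell_zero]
  rw [Function.update_of_ne h0, hm a ha]
  unfold yData
  by_cases h3 : a < g.Bv
  · rw [if_pos h3, if_pos h3]
  rw [if_neg h3, if_neg h3]
  by_cases h4 : g.Bv + 2 ≤ a ∧ a < g.Bv + 2 + g.lenX
  · rw [if_pos h4, if_pos (by omega), show a - g.Bv = 2 + (a - (g.Bv + 2)) by omega, g.ycell_x (by omega)]
  rw [if_neg h4]
  by_cases h5 : g.Bv + 2 + g.lenX ≤ a ∧ a < g.Bv + 2 + g.lenX + g.lenY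
  · rw [if_pos h5, if_pos (by omega), show a - g.Bv = 2 + g.lenX + (a - (g.Bv + 2 + g.lenX)) by omega,
      g.ycell_y (by omega)]
  rw [if_neg h5, if_neg (by omega)]

/-! ### Clearing -/

/-- Membership in the cleared registers. [folklore] -/
theorem mem_clearedRegs (a : ℕ) : a ∈ clearedRegs ↔ a < 100 ∧ ¬ ((10 ≤ a ∧ a ≤ 13) ∨ a = 25) := by
  simp [clearedRegs]; omega

/-- `clearedRegs` has `95` elements. [folklore] -/
theorem length_clearedRegs : clearedRegs.length = 95 := by decide

/-! ### The whole build -/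

/-- The time of the build. [folklore] -/
noncomputable def Tpre : ℕ :=
  7 * g.Lx + 32 + 21 + (Nat.size g.Ny * 4 + 1) + 16 + (3 + ((g.lenX * (44 + 2) + 1) + 0)) +
    (4 + ((g.lenY * (41 + 2) + 1) + 0)) + 5 + 95

/-- **Setup, part A** as a whole. [folklore] -/
theorem setupA_spec (hF : g.Fits W) :
    Achieves W O setupA (relocated g.x)
      (fun m' => g.Regs m' ∧ m' 1 = g.X - 1 ∧ m' 30 = g.Ny ∧ m' 31 = 0 ∧
        ∀ a, 100 ≤ a → m' a = relocated g.x a) (32 + (21 + 0)) := by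
  unfold setupA
  refine Achieves.seqs_cons (g.setupA1_spec hF) ?_
  rintro m₁ ⟨hR₁, hD₁⟩
  exact Achieves.seqs_cons (g.setupA2_spec hF hR₁ hD₁) (fun _ h => Achieves.seqs_nil h)

/-- **The build.** On the initial memory of the `OV` input (word size `W` with `g.Fits W`), `pre`
ends, within `Tpre` steps, in the closed-form memory `finMem`: environment registers
`Bv, Sv, 0, Pw`, the threshold register, all other registers `0`, and the data `finData`
(the relocated input and the emulated `DTW` input). [folklore] -/
theorem pre_spec (hF : g.Fits W) :
    Achieves W O (pre g.kD g.cD) (initFun g.x) (fun m => m = g.finMem) g.Tpre := by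
  obtain ⟨hX, hXLx, hBv, hSv, htop, hNyV, hPwV, hcDV, hLx, edd, eL, eK1, eLX, eLY, eK2, eper, eperY, eLK,
    elenX, elenY, eNy, eM1, eM2, eB0, eSVG, erho1, eSNVG, esig3, ethr, h12, hSVG, hSNVG, hL1, hA, hrho,
    hrs, hK2A, hLXA, hMK, hnrho, hnsig⟩ := g.facts hF
  have hLxW : 2 * g.Lx + 102 < 2 ^ W := by omega
  unfold pre Tpre
  refine Achieves.mono (T := 7 * g.Lx + ((32 + (21 + 0)) + ((Nat.size g.Ny * 4 + 1) + (16 +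
    ((3 + ((g.lenX * (44 + 2) + 1) + 0)) + ((4 + ((g.lenY * (41 + 2) + 1) + 0)) + (5 + (95 + 0))))))))
    ?_ (fun _ h => h) (by omega)
  -- relocate
  refine Achieves.seqs_cons (R := fun m => m = relocated g.x) (T₁ := 7 * g.Lx)
    (fun qs => ⟨relocated g.x, 7 * g.Lx, le_rfl, ?_, rfl⟩) ?_
  · have h2 := g.two_le_Lx
    unfold Lx at h2 hLxW
    exact relocate_exec (by omega) hF.input (by omega) qs
  rintro m rfl
  -- setup
  refine Achieves.seqs_cons (g.setupA_spec hF) ?_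
  rintro m₂ ⟨hR₂, -, h30, h31, hD₂⟩
  refine Achieves.seqs_cons (sizeLoop_spec (O := O) h30 h31 (by omega)) ?_
  rintro m₃ ⟨s31, -, sf⟩
  have hR₃ : g.Regs m₃ := hR₂.of_frame fun a ha => sf a (by omega) (by omega)
  have hD₃ : ∀ a, 100 ≤ a → m₃ a = relocated g.x a := fun a ha => by
    rw [sf a (by omega) (by omega), hD₂ a ha]
  refine Achieves.seqs_cons (g.setupB_spec hF hR₃ s31 hD₃) ?_
  rintro m₄ ⟨hR₄, hE₄, hD₄⟩
  -- the two curves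
  refine Achieves.seqs_cons (g.xLoop_spec hF hR₄ hE₄ hD₄) fun m₅ h₅ => ?_
  refine Achieves.seqs_cons (g.yLoop_spec hF h₅) fun m₆ h₆ => ?_
  obtain ⟨hR₆, hE₆, -, -, -, hD₆⟩ := h₆
  -- header
  refine Achieves.seqs_cons (R := fun m₇ => g.Regs m₇ ∧ g.ERegs m₇ ∧ ∀ a, 100 ≤ a → m₇ a = g.finData a)
    (T₁ := 5) ?_ ?_
  · obtain ⟨r0, r2, r3, r4, r5, r6, r7, r8, r9, r10, r18, r19, r20, r21, r22, r23, r24, r25, r26, r27⟩ := hR₆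
    obtain ⟨r11, r12, r13⟩ := hE₆
    have hPw1 : 1 ≤ g.Pw := Nat.one_le_two_pow
    refine achieves_block_of_eq (fun m' hm' => ?_) le_rfl
    simp (disch := first | omega | decide) only [execOps_cons, execOps_nil, execOp, Operand.write,
      Operand.read, merge_apply_of_lt, update_merge_of_lt, update_merge_of_le,
      Function.update_self, Function.update_of_ne, BinOp.eval_add_of_lt,
      BinOp.eval_mod, BinOp.eval_band, Nat.and_self, r24, r22, r10, r13] at hm'
    subst hm'
    refine ⟨⟨?_, ?_, ?_, ?_, ?_, ?_, ?_, ?_, ?_, ?_, ?_, ?_, ?_, ?_, ?_, ?_, ?_, ?_, ?_, ?_⟩, ⟨?_, ?_, ?_⟩,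
      fun a ha => ?data⟩
    case data =>
      (try simp (disch := first | omega | decide) only [merge_apply_of_le]); exact g.finData_header hD₆ a ha
    all_goals (try simp (disch := first | omega | decide) only [merge_apply_of_lt, Function.update_of_ne])
    all_goals assumption
  rintro m₇ ⟨hR₇, hE₇, hD₇⟩
  -- clearing
  refine Achieves.seqs_cons (T₁ := 95) (T₂ := 0) ?_ fun _ h => Achieves.seqs_nil h
  refine Achieves.block ?_ (by rw [List.length_map, length_clearedRegs])
  show execOps W m₇ (clearedRegs.map fun i => ((.band, CliqueRed.r i, CliqueRed.im 0, CliqueRed.im 0) : OpSpec)) =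
    g.finMem
  rw [CliqueRed.execOps_clear]
  funext a
  unfold finMem
  simp only [mem_clearedRegs]
  by_cases ha : a < 100
  · rw [if_pos ha]
    by_cases h10 : a = 10; · subst h10; simp [hR₇.r10]
    by_cases h11 : a = 11; · subst h11; simp [hE₇.r11]
    by_cases h12 : a = 12; · subst h12; simp [hE₇.r12]
    by_cases h13 : a = 13; · subst h13; simp [hE₇.r13]
    by_cases h25 : a = 25; · subst h25; simp [hR₇.r25]
    rw [if_pos ⟨ha, by omega⟩, if_neg h10, if_neg h11, if_neg h13, if_neg h25]
  · rw [if_neg (by omega), if_neg ha, hD₇ a (by omega)]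

end Params

end Prog

end DTWRed

end Literature.Computability.FineGrained
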